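import Mathlib

/-!
# The Lyapunov skew-cut semigroup bound: what a 3-L certificate proves (instab g11, cell `ns-blowup`, 2026-08-26)

HONEST FRAMING (human ruling D-0035): nothing here is a claim about Navier–Stokes blow-up.
WHAT THIS IS NOT: not NS evidence. These are the analysis-free sentences of THEOREM 3-L of
`instab/INSTAB-BRIDGE.md` §11 (l.108–109), the Lyapunov skew-cut format by which the cell's D2
certificate (cap seat, `d2_cert.py`; float gate P-EMERGE-X0 PART 3e/3f/3h) turns ONE verified
operator inequality into the `H²`-semigroup bound `M_ω^{(2)} ≤ M_G` that rung R-β (rope emergence)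
consumes. Everything is stated for an abstract trajectory in an inner-product space, so that the only
analysis left outside the kernel is «the linearised operator generates classical trajectories».
PRIOR ART IN THE TREE (landed first, cap g3, p412139): the finite-dimensional form of the energy
argument — `Summit.NavierStokesRegularity.FluidComputer.LyapunovSemigroupBound.quadForm_le_exp_mul` /
`normSq_le_exp_mul` for `Matrix n n ℂ` and curves `u' = A u`; the trajectory-bound lemmas below
restate that argument one level up (any `InnerProductSpace 𝕜 E`, bounded symmetric weight,
one-sided derivatives, hypothesis (L) on a domain), which is the form the infinite-dimensional
statement with an unbounded generator instantiates without truncation; the Schur-pivot, smoothing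
and (in `EmergenceBootstrap`) Duhamel pieces are not in p412139.

* `le_mul_exp_of_deriv_le` — scalar Grönwall in exponential form: `V' ≤ 2ω V` on `[0, T)` gives
  `V t ≤ V 0 · e^{2ωt}` on `[0, T]`.
* `hasDerivWithinAt_re_inner_weight` — for a symmetric bounded weight `G`,
  `d/dt Re⟪G u, u⟫ = 2 Re⟪G u, u'⟫` along any differentiable trajectory.
* `re_inner_weight_le_mul_exp`, `norm_sq_le_of_lyapunov_weight`, `norm_le_of_lyapunov_weight` —
  THEOREM 3-L (l.108): if `m‖x‖² ≤ Re⟪Gx, x⟫ ≤ M‖x‖²` and `Re⟪G u, u' − ω u⟫ ≤ 0` along the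
  trajectory, then `‖u t‖ ≤ √(M/m) · e^{ωt} · ‖u 0‖`; `norm_le_of_generator_form` is the same with
  hypothesis (L) stated on the generator: `Re⟪G w, A w⟫ ≤ ω Re⟪G w, w⟫` for every `w` in the domain.
* `neg_mul_sq_add_mul_le`, `sum_le_neg_pivot_mul_sq`, `sum_nonpos_of_pivots_pos`,
  `sum_nonpos_of_schur_two` — VERIFYING (L) (l.109, the «Schur step»): if the unit-diagonal forms are
  bounded by `−η_i a_i²`, the nearest-neighbour cross forms by `b_i a_i a_{i+1}`, and the recursive
  pivots `p₀ = η₀`, `p_{i+1} = η_{i+1} − b_i²/(4 p_i)` are all positive (the D2 driver's print «all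
  LDLᵀ pivots > 0»), then the total form is `≤ 0`; the two-unit case is the head∣tail junction with
  cap's `b²/(4τη_t)` correction.
* `add_mul_le_mul_exp_of_deriv_le`, `le_mul_exp_div_of_deriv_le`, `re_inner_weight_le_mul_exp_div`
  (appended, v2) — the two-level SMOOTHING sentence behind the constant `S` of l.111: if the lower
  form dissipates the higher one, `V₁' + c V₂ ≤ 2ω V₁`, and `V₂' ≤ 2ω V₂`, then
  `V₁ t + c t V₂ t ≤ e^{2ωt} V₁ 0`, hence `V₂ t ≤ e^{2ωt} V₁ 0 / (c t)` — the abstract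
  `‖e^{tA}‖_{1→2} ≤ S t^{−1/2} e^{ωt}`; `norm_le_of_two_level` (v4) is the NORM form with the
  constant displayed: `‖u t‖ ≤ √(M₁/(c·m₂)) · √(Re⟪D₁ u₀, u₀⟫/t) · e^{ωt}` when
  `Re⟪G₁x,x⟫ ≤ M₁ Re⟪D₁x,x⟫` (reference `H¹`-level weight `D₁`) and `m₂‖x‖² ≤ Re⟪G₂x,x⟫`.

Mathlib only; no new definitions.
-/

noncomputable section

namespace Summit.NavierStokesRegularity.FluidComputer.LyapunovSkewCutSemigroup

open Set Filter RCLike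
open scoped InnerProductSpace Topology

section Scalar

/-- **Scalar Grönwall, exponential form.** If `V` has (one-sided) derivative `V'` within `[0, T]` at
every point of `[0, T]` and `V' t ≤ 2ω·V t` on `[0, T)`, then `V t ≤ V 0 · e^{2ωt}` on `[0, T]`. -/
theorem le_mul_exp_of_deriv_le {V V' : ℝ → ℝ} {T ω : ℝ}
    (hV : ∀ t ∈ Icc 0 T, HasDerivWithinAt V (V' t) (Icc 0 T) t)
    (hle : ∀ t ∈ Ico 0 T, V' t ≤ 2 * ω * V t) :
    ∀ t ∈ Icc 0 T, V t ≤ V 0 * Real.exp (2 * ω * t) := by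
  intro t ht
  have hcont : ContinuousOn V (Icc 0 T) := fun τ hτ => (hV τ hτ).continuousWithinAt
  have hbound : ∀ τ ∈ Ico 0 T, V' τ ≤ 2 * ω * V τ + 0 := fun τ hτ => by
    rw [add_zero]; exact hle τ hτ
  have hgron := le_gronwallBound_of_liminf_deriv_right_le (f := V) (f' := V') (δ := V 0)
    (K := 2 * ω) (ε := 0) (a := 0) (b := T) hcont (fun τ hτ r hr => ?_) le_rfl hbound t ht
  · rw [sub_zero, gronwallBound_ε0] at hgron
    exact hgron
  · have hmem_nhds : Icc 0 T ∈ 𝓝[Ici τ] τ :=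
      mem_nhdsWithin.2 ⟨Iio T, isOpen_Iio, hτ.2, fun z hz => ⟨hτ.1.trans hz.2, hz.1.le⟩⟩
    exact ((hV τ (Ico_subset_Icc_self hτ)).mono_of_mem_nhdsWithin hmem_nhds)
      |>.liminf_right_slope_le hr

end Scalar

section Weight

variable {𝕜 E : Type*} [RCLike 𝕜] [NormedAddCommGroup E] [InnerProductSpace 𝕜 E]
  [NormedSpace ℝ E]

/-- **Derivative of a Lyapunov form along a trajectory.** For a bounded (real-linear) weight `G`
that is symmetric for the inner product, `⟪G x, y⟫ = ⟪x, G y⟫`, and a trajectory `u` with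
derivative `u'` at `t` (within `s`), the form `τ ↦ Re⟪G (u τ), u τ⟫` has derivative
`2 Re⟪G (u t), u'⟫` at `t` (within `s`). -/
theorem hasDerivWithinAt_re_inner_weight {G : E →L[ℝ] E}
    (hG : ∀ x y : E, ⟪G x, y⟫_𝕜 = ⟪x, G y⟫_𝕜) {u : ℝ → E} {u' : E} {s : Set ℝ} {t : ℝ}
    (hu : HasDerivWithinAt u u' s t) :
    HasDerivWithinAt (fun τ => re ⟪G (u τ), u τ⟫_𝕜) (2 * re ⟪G (u t), u'⟫_𝕜) s t := by
  have h1 := (G.hasFDerivAt.comp_hasDerivWithinAt t hu).inner 𝕜 hu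
  have h2 := (reCLM : 𝕜 →L[ℝ] ℝ).hasFDerivAt.comp_hasDerivWithinAt t h1
  have h3 : (⇑(reCLM : 𝕜 →L[ℝ] ℝ) ∘ fun τ => ⟪(⇑G ∘ u) τ, u τ⟫_𝕜) =
      fun τ => re ⟪G (u τ), u τ⟫_𝕜 := by
    funext τ; rfl
  rw [h3] at h2
  refine h2.congr_deriv ?_
  simp only [reCLM_apply, map_add, Function.comp_apply]
  rw [hG u' (u t), ← inner_conj_symm (G (u t)) u', conj_re]
  ring

/-- **The weighted energy grows at most like `e^{2ωt}`.** If `G` is a symmetric bounded weight, the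
trajectory `u` has derivative `u' t` within `[0, T]` at every `t ∈ [0, T]`, and the Lyapunov
inequality `Re⟪G (u t), u' t⟫ ≤ ω · Re⟪G (u t), u t⟫` (that is, `Re⟪G u, u' − ω u⟫ ≤ 0`) holds on
`[0, T)`, then `Re⟪G (u t), u t⟫ ≤ Re⟪G (u 0), u 0⟫ · e^{2ωt}` on `[0, T]`. -/
theorem re_inner_weight_le_mul_exp {G : E →L[ℝ] E}
    (hG : ∀ x y : E, ⟪G x, y⟫_𝕜 = ⟪x, G y⟫_𝕜) {ω T : ℝ} {u u' : ℝ → E}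
    (hu : ∀ t ∈ Icc 0 T, HasDerivWithinAt u (u' t) (Icc 0 T) t)
    (hQ : ∀ t ∈ Ico 0 T, re ⟪G (u t), u' t⟫_𝕜 ≤ ω * re ⟪G (u t), u t⟫_𝕜) :
    ∀ t ∈ Icc 0 T, re ⟪G (u t), u t⟫_𝕜 ≤ re ⟪G (u 0), u 0⟫_𝕜 * Real.exp (2 * ω * t) :=
  le_mul_exp_of_deriv_le (V := fun τ => re ⟪G (u τ), u τ⟫_𝕜)
    (V' := fun τ => 2 * re ⟪G (u τ), u' τ⟫_𝕜)
    (fun t ht => hasDerivWithinAt_re_inner_weight hG (hu t ht))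
    (fun t ht => by have := hQ t ht; nlinarith)

/-- **THEOREM 3-L, squared form (`INSTAB-BRIDGE` §11 l.108).** Let `G` be a symmetric bounded
weight with `m‖x‖² ≤ Re⟪G x, x⟫ ≤ M‖x‖²`. If the trajectory `u` (derivative `u'` within `[0, T]`)
satisfies the Lyapunov inequality `Re⟪G (u t), u' t⟫ ≤ ω · Re⟪G (u t), u t⟫` on `[0, T)`, then
`m‖u t‖² ≤ e^{2ωt} · M‖u 0‖²` on `[0, T]`. -/
theorem norm_sq_le_of_lyapunov_weight {G : E →L[ℝ] E}
    (hG : ∀ x y : E, ⟪G x, y⟫_𝕜 = ⟪x, G y⟫_𝕜) {m M ω T : ℝ}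
    (hm : ∀ x : E, m * ‖x‖ ^ 2 ≤ re ⟪G x, x⟫_𝕜) (hM : ∀ x : E, re ⟪G x, x⟫_𝕜 ≤ M * ‖x‖ ^ 2)
    {u u' : ℝ → E} (hu : ∀ t ∈ Icc 0 T, HasDerivWithinAt u (u' t) (Icc 0 T) t)
    (hQ : ∀ t ∈ Ico 0 T, re ⟪G (u t), u' t⟫_𝕜 ≤ ω * re ⟪G (u t), u t⟫_𝕜) :
    ∀ t ∈ Icc 0 T, m * ‖u t‖ ^ 2 ≤ Real.exp (2 * ω * t) * (M * ‖u 0‖ ^ 2) := by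
  intro t ht
  have h1 := re_inner_weight_le_mul_exp hG hu hQ t ht
  have h2 := hm (u t)
  have h3 := hM (u 0)
  have h4 : 0 ≤ Real.exp (2 * ω * t) := (Real.exp_pos _).le
  calc m * ‖u t‖ ^ 2 ≤ re ⟪G (u t), u t⟫_𝕜 := h2
    _ ≤ re ⟪G (u 0), u 0⟫_𝕜 * Real.exp (2 * ω * t) := h1
    _ ≤ M * ‖u 0‖ ^ 2 * Real.exp (2 * ω * t) := by gcongr
    _ = Real.exp (2 * ω * t) * (M * ‖u 0‖ ^ 2) := by ring

/-- **THEOREM 3-L, the bound `M_G e^{ωt}` (`INSTAB-BRIDGE` §11 l.108).** Let `G` be a symmetric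
bounded weight with `m‖x‖² ≤ Re⟪G x, x⟫ ≤ M‖x‖²`, `m > 0`. If the trajectory `u` (derivative `u'`
within `[0, T]`) satisfies the Lyapunov inequality `Re⟪G (u t), u' t⟫ ≤ ω · Re⟪G (u t), u t⟫` on
`[0, T)`, then `‖u t‖ ≤ √(M/m) · e^{ωt} · ‖u 0‖` on `[0, T]`: the constant `M_G = √(M/m)` of the
certificate. -/
theorem norm_le_of_lyapunov_weight {G : E →L[ℝ] E}
    (hG : ∀ x y : E, ⟪G x, y⟫_𝕜 = ⟪x, G y⟫_𝕜) {m M ω T : ℝ} (hm0 : 0 < m)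
    (hm : ∀ x : E, m * ‖x‖ ^ 2 ≤ re ⟪G x, x⟫_𝕜) (hM : ∀ x : E, re ⟪G x, x⟫_𝕜 ≤ M * ‖x‖ ^ 2)
    {u u' : ℝ → E} (hu : ∀ t ∈ Icc 0 T, HasDerivWithinAt u (u' t) (Icc 0 T) t)
    (hQ : ∀ t ∈ Ico 0 T, re ⟪G (u t), u' t⟫_𝕜 ≤ ω * re ⟪G (u t), u t⟫_𝕜) :
    ∀ t ∈ Icc 0 T, ‖u t‖ ≤ Real.sqrt (M / m) * Real.exp (ω * t) * ‖u 0‖ := by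
  intro t ht
  have h1 := norm_sq_le_of_lyapunov_weight hG hm hM hu hQ t ht
  have hx : M / m ≤ Real.sqrt (M / m) ^ 2 := by
    rcases le_total 0 (M / m) with h | h
    · rw [Real.sq_sqrt h]
    · exact h.trans (sq_nonneg _)
  have hexp : Real.exp (ω * t) ^ 2 = Real.exp (2 * ω * t) := by
    rw [sq, ← Real.exp_add]; ring_nf
  have hsq : ‖u t‖ ^ 2 ≤ (Real.sqrt (M / m) * Real.exp (ω * t) * ‖u 0‖) ^ 2 := by
    have h2 : ‖u t‖ ^ 2 ≤ M / m * Real.exp (2 * ω * t) * ‖u 0‖ ^ 2 := by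
      rw [div_mul_eq_mul_div, div_mul_eq_mul_div, le_div_iff₀ hm0]; linarith
    have h3 : M / m * Real.exp (2 * ω * t) * ‖u 0‖ ^ 2 ≤
        Real.sqrt (M / m) ^ 2 * Real.exp (2 * ω * t) * ‖u 0‖ ^ 2 := by
      have : 0 ≤ Real.exp (2 * ω * t) * ‖u 0‖ ^ 2 := by positivity
      nlinarith
    calc ‖u t‖ ^ 2 ≤ Real.sqrt (M / m) ^ 2 * Real.exp (2 * ω * t) * ‖u 0‖ ^ 2 := h2.trans h3
      _ = (Real.sqrt (M / m) * Real.exp (ω * t) * ‖u 0‖) ^ 2 := by rw [← hexp]; ring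
  have hnonneg : 0 ≤ Real.sqrt (M / m) * Real.exp (ω * t) * ‖u 0‖ := by positivity
  exact (pow_le_pow_iff_left₀ (norm_nonneg _) hnonneg two_ne_zero).mp hsq

/-- **THEOREM 3-L from hypothesis (L) on the generator (`INSTAB-BRIDGE` §11 l.108).** Let `G` be a
symmetric bounded weight with `m‖x‖² ≤ Re⟪G x, x⟫ ≤ M‖x‖²`, `m > 0`, and let `A : E → E` (the
generator, defined on a domain `D`) satisfy HYPOTHESIS (L): `Re⟪G w, A w⟫ ≤ ω · Re⟪G w, w⟫` for every
`w ∈ D` — i.e. `Re⟪G w, (A − ω) w⟫ ≤ 0`, the inequality a 3-L certificate verifies. Then every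
classical trajectory `u` of `u' = A u` on `[0, T]` that stays in `D` obeys
`‖u t‖ ≤ √(M/m) · e^{ωt} · ‖u 0‖`; in particular `‖e^{tA}‖ ≤ M_G e^{ωt}` with `M_G = √(M/m)` on the
closure of such trajectories. -/
theorem norm_le_of_generator_form {G : E →L[ℝ] E}
    (hG : ∀ x y : E, ⟪G x, y⟫_𝕜 = ⟪x, G y⟫_𝕜) {m M ω T : ℝ} (hm0 : 0 < m)
    (hm : ∀ x : E, m * ‖x‖ ^ 2 ≤ re ⟪G x, x⟫_𝕜) (hM : ∀ x : E, re ⟪G x, x⟫_𝕜 ≤ M * ‖x‖ ^ 2)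
    {D : Set E} {A : E → E} (hL : ∀ w ∈ D, re ⟪G w, A w⟫_𝕜 ≤ ω * re ⟪G w, w⟫_𝕜)
    {u : ℝ → E} (hu : ∀ t ∈ Icc 0 T, HasDerivWithinAt u (A (u t)) (Icc 0 T) t)
    (huD : ∀ t ∈ Ico 0 T, u t ∈ D) :
    ∀ t ∈ Icc 0 T, ‖u t‖ ≤ Real.sqrt (M / m) * Real.exp (ω * t) * ‖u 0‖ :=
  norm_le_of_lyapunov_weight hG hm0 hm hM (u' := fun τ => A (u τ)) hu
    (fun t ht => hL (u t) (huD t ht))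

end Weight

section Schur

/-- **The elementary absorption step.** For `p > 0`: `−p x² + b x y ≤ b²/(4p) · y²`
(complete the square: `4p · (b²/(4p) y² + p x² − b x y) = (2 p x − b y)² ≥ 0`). -/
theorem neg_mul_sq_add_mul_le {p b x y : ℝ} (hp : 0 < p) :
    -p * x ^ 2 + b * x * y ≤ b ^ 2 / (4 * p) * y ^ 2 := by
  rw [← sub_nonneg]
  have h : b ^ 2 / (4 * p) * y ^ 2 - (-p * x ^ 2 + b * x * y) = (2 * p * x - b * y) ^ 2 / (4 * p) := by
    field_simp
    ring
  rw [h]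
  positivity

/-- **Sequential Schur complements bound a nearest-neighbour form by its last pivot.** Let units
`0, …, n` carry diagonal margins `η i`, nearest-neighbour coupling bounds `b i` (between units `i`
and `i+1`) and amplitudes `a i`, and let `p` be the recursive pivots `p 0 = η 0`,
`p (i+1) = η (i+1) − (b i)²/(4 p i)`, all positive up to `n`. Then
`∑_{i ≤ n} (−η i · (a i)²) + ∑_{i < n} b i · a i · a (i+1) ≤ −p n · (a n)²`. -/
theorem sum_le_neg_pivot_mul_sq {η b a p : ℕ → ℝ} (hp0 : p 0 = η 0)
    (hps : ∀ i, p (i + 1) = η (i + 1) - b i ^ 2 / (4 * p i)) :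
    ∀ n, (∀ i ≤ n, 0 < p i) →
      (∑ i ∈ Finset.range (n + 1), (-η i * a i ^ 2)) +
        (∑ i ∈ Finset.range n, b i * a i * a (i + 1)) ≤ -p n * a n ^ 2 := by
  intro n
  induction n with
  | zero =>
    intro _
    simp [hp0]
  | succ n ih =>
    intro hpos
    have hih := ih (fun i hi => hpos i (hi.trans (Nat.le_succ n)))
    have hpn : 0 < p n := hpos n (Nat.le_succ n)
    rw [Finset.sum_range_succ (fun i => -η i * a i ^ 2) (n + 1),
      Finset.sum_range_succ (fun i => b i * a i * a (i + 1)) n]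
    have hstep := neg_mul_sq_add_mul_le (b := b n) (x := a n) (y := a (n + 1)) hpn
    have : -p n * a n ^ 2 + b n * a n * a (n + 1) + -η (n + 1) * a (n + 1) ^ 2 ≤
        -p (n + 1) * a (n + 1) ^ 2 := by
      rw [hps n]
      nlinarith
    linarith

/-- **VERIFYING (L): positive pivots make the total form non-positive (`INSTAB-BRIDGE` §11 l.109;
the D2 driver's «all LDLᵀ pivots > 0 ⇒ certificate shape holds»).** If the unit-diagonal forms
satisfy `q i ≤ −η i · (a i)²`, the nearest-neighbour cross forms satisfy `|c i| ≤ b i · a i · a (i+1)`,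
and the recursive pivots `p 0 = η 0`, `p (i+1) = η (i+1) − (b i)²/(4 p i)` are positive for
`i ≤ n`, then `∑_{i ≤ n} q i + ∑_{i < n} c i ≤ 0`. -/
theorem sum_nonpos_of_pivots_pos {q c η b a p : ℕ → ℝ} {n : ℕ}
    (hq : ∀ i ≤ n, q i ≤ -η i * a i ^ 2) (hc : ∀ i < n, |c i| ≤ b i * a i * a (i + 1))
    (hp0 : p 0 = η 0) (hps : ∀ i, p (i + 1) = η (i + 1) - b i ^ 2 / (4 * p i))
    (hpos : ∀ i ≤ n, 0 < p i) :
    (∑ i ∈ Finset.range (n + 1), q i) + (∑ i ∈ Finset.range n, c i) ≤ 0 := by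
  have h1 : (∑ i ∈ Finset.range (n + 1), q i) ≤ ∑ i ∈ Finset.range (n + 1), (-η i * a i ^ 2) :=
    Finset.sum_le_sum fun i hi => hq i (Nat.lt_succ_iff.mp (Finset.mem_range.mp hi))
  have h2 : (∑ i ∈ Finset.range n, c i) ≤ ∑ i ∈ Finset.range n, b i * a i * a (i + 1) :=
    Finset.sum_le_sum fun i hi => (le_abs_self _).trans (hc i (Finset.mem_range.mp hi))
  have h3 := sum_le_neg_pivot_mul_sq (a := a) hp0 hps n hpos
  have h4 : -p n * a n ^ 2 ≤ 0 := by
    have := hpos n le_rfl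
    nlinarith [sq_nonneg (a n)]
  linarith

/-- **The head∣tail junction (two units; `INSTAB-BRIDGE` §11 l.109, cap's `b²/(4τη_t)`
correction).** If the head form is `≤ −η_h a²`, the tail form is `≤ −η_t c²`, the cross form is
`≤ b·a·c` in absolute value, `η_h > 0` and the corrected tail pivot `η_t − b²/(4η_h)` is positive
(equivalently `b² < 4 η_h η_t`), then the total form is `≤ 0`. -/
theorem sum_nonpos_of_schur_two {qh qt qc ηh ηt b a c : ℝ}
    (hqh : qh ≤ -ηh * a ^ 2) (hqt : qt ≤ -ηt * c ^ 2) (hqc : |qc| ≤ b * a * c)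
    (hηh : 0 < ηh) (hpiv : 0 < ηt - b ^ 2 / (4 * ηh)) :
    qh + qc + qt ≤ 0 := by
  have h1 := neg_mul_sq_add_mul_le (b := b) (x := a) (y := c) hηh
  have h2 := (le_abs_self qc).trans hqc
  have h3 : -(ηt - b ^ 2 / (4 * ηh)) * c ^ 2 ≤ 0 := by nlinarith [sq_nonneg c]
  nlinarith

end Schur

section Smoothing

/-- **Two-level Lyapunov smoothing, scalar form (`INSTAB-BRIDGE` §11 l.111, the constant `S`).** Let
`V₁, V₂` have (one-sided) derivatives `V₁', V₂'` within `[0, T]` on `[0, T]`, and suppose on `[0, T)`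
the COUPLED inequality `V₁' + c·V₂ ≤ 2ω·V₁` (the lower-order form dissipates the higher-order one)
and the plain inequality `V₂' ≤ 2ω·V₂`, with `c ≥ 0`. Then the `t`-weighted combination obeys
`V₁ t + c·t·V₂ t ≤ V₁ 0 · e^{2ωt}` on `[0, T]` (proof: `W := V₁ + c·t·V₂` satisfies `W' ≤ 2ω W`). -/
theorem add_mul_le_mul_exp_of_deriv_le {V₁ V₂ V₁' V₂' : ℝ → ℝ} {T ω c : ℝ} (hc : 0 ≤ c)
    (hV₁ : ∀ t ∈ Icc 0 T, HasDerivWithinAt V₁ (V₁' t) (Icc 0 T) t)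
    (hV₂ : ∀ t ∈ Icc 0 T, HasDerivWithinAt V₂ (V₂' t) (Icc 0 T) t)
    (h₁ : ∀ t ∈ Ico 0 T, V₁' t + c * V₂ t ≤ 2 * ω * V₁ t)
    (h₂ : ∀ t ∈ Ico 0 T, V₂' t ≤ 2 * ω * V₂ t) :
    ∀ t ∈ Icc 0 T, V₁ t + c * t * V₂ t ≤ V₁ 0 * Real.exp (2 * ω * t) := by
  have hW : ∀ t ∈ Icc 0 T, HasDerivWithinAt (fun τ => V₁ τ + c * τ * V₂ τ)
      (V₁' t + (c * 1 * V₂ t + c * t * V₂' t)) (Icc 0 T) t := by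
    intro t ht
    have hid : HasDerivWithinAt (fun τ : ℝ => c * τ) (c * 1) (Icc 0 T) t :=
      (hasDerivWithinAt_id t _).const_mul c
    exact (hV₁ t ht).add (hid.mul (hV₂ t ht))
  have hmain := le_mul_exp_of_deriv_le (V := fun τ => V₁ τ + c * τ * V₂ τ)
    (V' := fun t => V₁' t + (c * 1 * V₂ t + c * t * V₂' t)) hW (fun t ht => by
      have e1 := h₁ t ht
      have e2 := h₂ t ht
      have hct : 0 ≤ c * t := mul_nonneg hc ht.1
      have e3 : c * t * V₂' t ≤ c * t * (2 * ω * V₂ t) := mul_le_mul_of_nonneg_left e2 hct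
      show V₁' t + (c * 1 * V₂ t + c * t * V₂' t) ≤ 2 * ω * (V₁ t + c * t * V₂ t)
      nlinarith)
  intro t ht
  have := hmain t ht
  simpa using this

/-- **Two-level smoothing: the higher form is controlled by the lower one at time zero.** Under the
hypotheses of `add_mul_le_mul_exp_of_deriv_le` and `V₁ ≥ 0` on `[0, T]`, for every `t ∈ (0, T]`:
`V₂ t ≤ e^{2ωt} · V₁ 0 / (c·t)` (`c > 0`) — the abstract `t^{−1/2}`-smoothing estimate
`‖e^{tA}‖_{1→2} ≤ S t^{−1/2} e^{ωt}` once `V₁, V₂` are the `H¹`- and `H²`-level Lyapunov forms. -/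
theorem le_mul_exp_div_of_deriv_le {V₁ V₂ V₁' V₂' : ℝ → ℝ} {T ω c : ℝ} (hc : 0 < c)
    (hV₁ : ∀ t ∈ Icc 0 T, HasDerivWithinAt V₁ (V₁' t) (Icc 0 T) t)
    (hV₂ : ∀ t ∈ Icc 0 T, HasDerivWithinAt V₂ (V₂' t) (Icc 0 T) t)
    (h₁ : ∀ t ∈ Ico 0 T, V₁' t + c * V₂ t ≤ 2 * ω * V₁ t)
    (h₂ : ∀ t ∈ Ico 0 T, V₂' t ≤ 2 * ω * V₂ t) (hpos : ∀ t ∈ Icc 0 T, 0 ≤ V₁ t) :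
    ∀ t ∈ Ioc 0 T, V₂ t ≤ Real.exp (2 * ω * t) * V₁ 0 / (c * t) := by
  intro t ht
  have ht' : t ∈ Icc 0 T := ⟨ht.1.le, ht.2⟩
  have h := add_mul_le_mul_exp_of_deriv_le hc.le hV₁ hV₂ h₁ h₂ t ht'
  have hct : 0 < c * t := mul_pos hc ht.1
  rw [le_div_iff₀ hct]
  have := hpos t ht'
  nlinarith

variable {𝕜 E : Type*} [RCLike 𝕜] [NormedAddCommGroup E] [InnerProductSpace 𝕜 E]
  [NormedSpace ℝ E]

/-- **Two-level smoothing along a trajectory (`INSTAB-BRIDGE` §11 l.111).** Let `G₁, G₂` be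
symmetric bounded weights (the `H¹`- and `H²`-level forms), `u` a trajectory with derivative `u'`
within `[0, T]`, and suppose on `[0, T)` the coupled Lyapunov inequality
`2 Re⟪G₁ u, u'⟫ + c · Re⟪G₂ u, u⟫ ≤ 2ω · Re⟪G₁ u, u⟫` (dissipation of the higher form) and the plain
one `Re⟪G₂ u, u'⟫ ≤ ω · Re⟪G₂ u, u⟫`, with `c > 0` and `Re⟪G₁ x, x⟫ ≥ 0`. Then for `t ∈ (0, T]`:
`Re⟪G₂ (u t), u t⟫ ≤ e^{2ωt} · Re⟪G₁ (u 0), u 0⟫ / (c·t)`. -/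
theorem re_inner_weight_le_mul_exp_div {G₁ G₂ : E →L[ℝ] E}
    (hG₁ : ∀ x y : E, ⟪G₁ x, y⟫_𝕜 = ⟪x, G₁ y⟫_𝕜) (hG₂ : ∀ x y : E, ⟪G₂ x, y⟫_𝕜 = ⟪x, G₂ y⟫_𝕜)
    (hG₁pos : ∀ x : E, 0 ≤ re ⟪G₁ x, x⟫_𝕜) {ω c T : ℝ} (hc : 0 < c) {u u' : ℝ → E}
    (hu : ∀ t ∈ Icc 0 T, HasDerivWithinAt u (u' t) (Icc 0 T) t)
    (h₁ : ∀ t ∈ Ico 0 T,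
      2 * re ⟪G₁ (u t), u' t⟫_𝕜 + c * re ⟪G₂ (u t), u t⟫_𝕜 ≤ 2 * ω * re ⟪G₁ (u t), u t⟫_𝕜)
    (h₂ : ∀ t ∈ Ico 0 T, re ⟪G₂ (u t), u' t⟫_𝕜 ≤ ω * re ⟪G₂ (u t), u t⟫_𝕜) :
    ∀ t ∈ Ioc 0 T, re ⟪G₂ (u t), u t⟫_𝕜 ≤
      Real.exp (2 * ω * t) * re ⟪G₁ (u 0), u 0⟫_𝕜 / (c * t) :=
  le_mul_exp_div_of_deriv_le (V₁ := fun τ => re ⟪G₁ (u τ), u τ⟫_𝕜)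
    (V₂ := fun τ => re ⟪G₂ (u τ), u τ⟫_𝕜) (V₁' := fun τ => 2 * re ⟪G₁ (u τ), u' τ⟫_𝕜)
    (V₂' := fun τ => 2 * re ⟪G₂ (u τ), u' τ⟫_𝕜) hc
    (fun t ht => hasDerivWithinAt_re_inner_weight hG₁ (hu t ht))
    (fun t ht => hasDerivWithinAt_re_inner_weight hG₂ (hu t ht)) h₁
    (fun t ht => by have := h₂ t ht; nlinarith) (fun t _ => hG₁pos (u t))

end Smoothing

section SmoothingNorm

variable {𝕜 E : Type*} [RCLike 𝕜] [NormedAddCommGroup E] [InnerProductSpace 𝕜 E]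
  [NormedSpace ℝ E]

/-- **Two-level smoothing, NORM form: the constant `S = √(M₁/(c·m₂))` (`INSTAB-BRIDGE` §11 l.111;
P-EMERGE-X0 PART 4).** In the setting of `re_inner_weight_le_mul_exp_div`, measure the lower
weight `G₁` against a reference weight `D₁` (the `H¹`-level form), `Re⟪G₁ x, x⟫ ≤ M₁ · Re⟪D₁ x, x⟫`
with `Re⟪D₁ x, x⟫ ≥ 0` and `M₁ ≥ 0`, and let the higher weight dominate the norm,
`m₂‖x‖² ≤ Re⟪G₂ x, x⟫` with `m₂ > 0`. Then for `t ∈ (0, T]`: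
`‖u t‖ ≤ √(M₁/(c·m₂)) · √(Re⟪D₁ (u 0), u 0⟫ / t) · e^{ωt}` — i.e.
`‖e^{tA}‖_{D₁ → ‖·‖} ≤ S · t^{−1/2} · e^{ωt}` with `S = √(M₁/(c·m₂))`. -/
theorem norm_le_of_two_level {G₁ G₂ D₁ : E →L[ℝ] E}
    (hG₁ : ∀ x y : E, ⟪G₁ x, y⟫_𝕜 = ⟪x, G₁ y⟫_𝕜) (hG₂ : ∀ x y : E, ⟪G₂ x, y⟫_𝕜 = ⟪x, G₂ y⟫_𝕜)
    (hG₁pos : ∀ x : E, 0 ≤ re ⟪G₁ x, x⟫_𝕜) {ω c T m₂ M₁ : ℝ} (hc : 0 < c) (hm₂ : 0 < m₂)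
    (hM₁ : 0 ≤ M₁) (hm₂' : ∀ x : E, m₂ * ‖x‖ ^ 2 ≤ re ⟪G₂ x, x⟫_𝕜)
    (hD₁ : ∀ x : E, 0 ≤ re ⟪D₁ x, x⟫_𝕜) (hM₁' : ∀ x : E, re ⟪G₁ x, x⟫_𝕜 ≤ M₁ * re ⟪D₁ x, x⟫_𝕜)
    {u u' : ℝ → E} (hu : ∀ t ∈ Icc 0 T, HasDerivWithinAt u (u' t) (Icc 0 T) t)
    (h₁ : ∀ t ∈ Ico 0 T,
      2 * re ⟪G₁ (u t), u' t⟫_𝕜 + c * re ⟪G₂ (u t), u t⟫_𝕜 ≤ 2 * ω * re ⟪G₁ (u t), u t⟫_𝕜)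
    (h₂ : ∀ t ∈ Ico 0 T, re ⟪G₂ (u t), u' t⟫_𝕜 ≤ ω * re ⟪G₂ (u t), u t⟫_𝕜) :
    ∀ t ∈ Ioc 0 T, ‖u t‖ ≤ Real.sqrt (M₁ / (c * m₂)) *
      Real.sqrt (re ⟪D₁ (u 0), u 0⟫_𝕜 / t) * Real.exp (ω * t) := by
  intro t ht
  have h := re_inner_weight_le_mul_exp_div hG₁ hG₂ hG₁pos hc hu h₁ h₂ t ht
  have ht0 : 0 < t := ht.1
  have hct : 0 < c * t := mul_pos hc ht0
  set D := re ⟪D₁ (u 0), u 0⟫_𝕜 with hD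
  have hD0 : 0 ≤ D := hD₁ (u 0)
  have hexp : Real.exp (ω * t) ^ 2 = Real.exp (2 * ω * t) := by
    rw [sq, ← Real.exp_add]; ring_nf
  -- chain: m₂‖u t‖² ≤ Re⟪G₂u,u⟫ ≤ e^{2ωt} Re⟪G₁u₀,u₀⟫/(ct) ≤ e^{2ωt} M₁ D/(ct)
  have h1 : m₂ * ‖u t‖ ^ 2 ≤ Real.exp (2 * ω * t) * (M₁ * D) / (c * t) := by
    calc m₂ * ‖u t‖ ^ 2 ≤ re ⟪G₂ (u t), u t⟫_𝕜 := hm₂' (u t)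
      _ ≤ Real.exp (2 * ω * t) * re ⟪G₁ (u 0), u 0⟫_𝕜 / (c * t) := h
      _ ≤ Real.exp (2 * ω * t) * (M₁ * D) / (c * t) := by
          gcongr
          exact hM₁' (u 0)
  have hsq : ‖u t‖ ^ 2 ≤ (Real.sqrt (M₁ / (c * m₂)) * Real.sqrt (D / t) * Real.exp (ω * t)) ^ 2 := by
    rw [mul_pow, mul_pow, Real.sq_sqrt (by positivity), Real.sq_sqrt (by positivity), hexp]
    have key : M₁ / (c * m₂) * (D / t) * Real.exp (2 * ω * t) =
        Real.exp (2 * ω * t) * (M₁ * D) / (c * t) / m₂ := by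
      field_simp
    rw [key, le_div_iff₀ hm₂]
    calc ‖u t‖ ^ 2 * m₂ = m₂ * ‖u t‖ ^ 2 := mul_comm _ _
      _ ≤ Real.exp (2 * ω * t) * (M₁ * D) / (c * t) := h1
  have hnonneg : 0 ≤ Real.sqrt (M₁ / (c * m₂)) * Real.sqrt (D / t) * Real.exp (ω * t) := by
    positivity
  exact (pow_le_pow_iff_left₀ (norm_nonneg _) hnonneg two_ne_zero).mp hsq

end SmoothingNorm

end Summit.NavierStokesRegularity.FluidComputer.LyapunovSkewCutSemigroup

end
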